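import Summits.NavierStokesRegularity.FluidComputer.PalasekTowerRegisterGlobal
import Literature.Analysis.FluidPDE.NSEnstrophyPersistenceForced
import Literature.Analysis.FluidPDE.AxisymQuotientRayAverage
import Literature.Analysis.FluidPDE.HolderEulerUniqueness
import Literature.Analysis.FluidPDE.ClassicalSolutionCalculus

/-!
# Every registered stage is UNIFORMLY SMOOTH: Tao's class, bounded derivatives, decaying slices,
# attained speed maxima

Cell `ns-blowup`, seat `ns-blowup-fc-prover-3` (g2; prover; D-0074 GROUP C/E «BRIDGE SUPPORT»;
bears_on LADDER-NS N1, route `PalasekTowerBreakdown`, child crux item stmt-NavierStokesRegularity-19249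
`HeredityAtOne` and parent 19178 — supports only, nothing claimed or closed). LABEL: E–C typing
(KERNEL analysis: every statement PROVED, no `Prop` introduced, no named fact used).
WHAT THIS IS NOT: not Navier–Stokes evidence — nothing is constructed or asserted to exist; the
theorems say what EVERY stage of the typed register (`Stage ν R S m k`, any rates `R`, any schedule
`S`, ANY margin set `m`, any level `k`, any viscosity `ν > 0`) must look like, by THEOREM, because a
stage is a classical finite-energy solution of the forced system from a Schwartz datum under a
Clay-class force (`Schedule.datum_decay`, `Schedule.force_smooth`, `Schedule.force_decay`).

## What is proved (no hypothesis beyond `0 < ν` and the stage)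

* §1 `Stage.hasBoundedSobolevNormsOn` — **Tao's class**: `u ∈ L^∞_t H^n_x([0, τ_k] × ℝ³)` for EVERY
  `n` (lit g10's kernel theorem `IsClassicalNSSolutionOn.hasBoundedSobolevNormsOn_of_clayForce`, Tao
  2013 Cor. 11.1 + persistence of regularity WITH force, fed with the stage's classicality on the
  closed slab, its energy clause, the schedule's Schwartz datum (`s.initial`) and Clay force).
* §2 `Stage.exists_norm_iteratedFDeriv_le` — **all spatial derivatives are bounded on the slab**:
  `‖Dⁿu(t, x)‖ ≤ B_n` for all `t ∈ [0, τ_k]`, all `x` (Sobolev imbedding `H²(ℝ³) ⊂ C_B` applied to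
  `Dⁿu(t)`, tree `HasBoundedSobolevNormsOn.exists_forall_norm_iteratedFDeriv_le`); in particular the
  velocity gradient (`exists_norm_fderiv_le`) — the register's strain FLOORS `c₁ A_j ≤ ‖Du(τ_j, x_j)‖`
  therefore sit under a finite (non-explicit) uniform gradient CEILING of the same stage — and every
  slice is Lipschitz with one constant (`exists_lipschitz`).
* §3 `Stage.tendsto_cocompact` — **every slice vanishes at spatial infinity** (finite energy +
  uniform Lipschitz bound, tree `tendsto_cocompact_of_eEnergy_lt_top`): a registered flow carries no
  speed plateau at infinity, so suprema over `ℝ³` are maxima: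
* §4 `Stage.exists_isMaxOn_norm` — at EVERY time of the slab the global speed maximum
  `max_x ‖u(t, x)‖` is ATTAINED; `Stage.exists_isMaxOn_norm_readout`: at each readout `τ_j`, `j ≤ k`,
  the attained maximum lies in the registered band `[c₁ Y_j, c₂ Y_j]` (floor in the ball, ceiling
  everywhere); `Stage.exists_isMaxOn_norm_le_ceiling`: on `[0, τ_j]` the attained maximum is
  `≤ c₂ Y_j`.

These are the inputs of the «first hitting at every hand-over» calculus (companion file
`PalasekTowerWindowFirstHitting.lean`, this seat): an attained maximum is where the anchor
inequality of `PalasekTowerRegisterGlobalFirstHitting.lean` (p417307, level `0`) can be written at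
the higher levels.

References: T. Tao, Anal. PDE 6 (2013) = arXiv:1108.1165, Cor. 11.1, Thm. 5.4 (iv)
[cite: Tao2011, Cor. 11.1]; R. A. Adams, J. J. F. Fournier, *Sobolev Spaces* (2003), Thm. 4.12
[cite: AdamsFournier2003, Thm. 4.12]; S. Palasek, arXiv:2605.13827 §3.3–§4
[cite: Palasek2026ElementaryModel, §4].
-/

noncomputable section

namespace Summit.NavierStokesRegularity.FluidComputer.PalasekTowerClayBridge

open Set MeasureTheory Filter Topology Function Real
open scoped ENNReal ContDiff NNReal
open Literature.Analysis.FluidPDE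

namespace Stage

variable {ν : ℝ} {R : TowerRates} {S : Schedule R} {m : Margins R} {k : ℕ}

/-! ## §1 Tao's class -/

/-- The slices of a stage are smooth (it is a classical solution on the closed slab). [folklore] -/
theorem contDiff_slice (s : Stage ν R S m k) {t : ℝ} (ht : t ∈ Icc 0 (S.τ k)) :
    ContDiff ℝ ∞ (s.u t) :=
  s.classical.contDiff_velocity ht

/-- The velocity of a stage is jointly continuous on the closed slab. [folklore] -/
theorem continuousOn_uncurry (s : Stage ν R S m k) :
    ContinuousOn (uncurry s.u) (Icc 0 (S.τ k) ×ˢ univ) :=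
  s.classical.smooth_velocity.continuousOn

/-- The datum of a stage is the schedule's Schwartz datum, so it has rapid spatial decay. [folklore] -/
theorem hasRapidSpatialDecay_zero (s : Stage ν R S m k) : HasRapidSpatialDecay (s.u 0) := by
  rw [s.initial]
  exact S.datum_decay

/-- The energy clause of a stage in the `ℝ≥0`-bound form consumed by the Literature theorems.
[folklore] -/
theorem exists_energy_le_coe (s : Stage ν R S m k) :
    ∃ C : ℝ≥0, ∀ t ∈ Icc 0 (S.τ k), ∫⁻ x, ‖s.u t x‖ₑ ^ 2 ≤ C := by
  obtain ⟨C, hCt, hC⟩ := s.energy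
  exact ⟨C.toNNReal, fun t ht => (hC t ht).trans (ENNReal.coe_toNNReal hCt.ne).ge⟩

/-- **Every stage lies in Tao's class `L^∞_t H^n_x([0, τ_k] × ℝ³)` for every `n`** (`ν > 0`; any
rates, schedule, margins, level): the `L²` norms of all spatial derivatives of the velocity are
bounded uniformly on the closed slab. This is lit g10's kernel theorem
`IsClassicalNSSolutionOn.hasBoundedSobolevNormsOn_of_clayForce` (Tao 2013 Cor. 11.1 with force +
persistence of regularity) applied to the stage: classical on `[0, τ_k]`, finite energy there,
Schwartz datum `S.u₀`, Clay-class force `S.f`. No named fact. [cite: Tao2011, Cor. 11.1] -/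
theorem hasBoundedSobolevNormsOn (hν : 0 < ν) (s : Stage ν R S m k) :
    HasBoundedSobolevNormsOn (Icc 0 (S.τ k)) s.u :=
  s.classical.hasBoundedSobolevNormsOn_of_clayForce hν (S.τ_pos k) s.exists_energy_le_coe
    s.hasRapidSpatialDecay_zero S.force_smooth S.force_decay

/-! ## §2 All spatial derivatives are bounded on the slab -/

/-- **Every spatial derivative of a stage's velocity is bounded on the slab**: for each `n` there is
`B ≥ 0` with `‖Dⁿ(u t) x‖ ≤ B` for all `t ∈ [0, τ_k]` and all `x` (Sobolev imbedding on the class of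
§1). The constant is not explicit. [cite: AdamsFournier2003, Thm. 4.12] -/
theorem exists_norm_iteratedFDeriv_le (hν : 0 < ν) (s : Stage ν R S m k) (n : ℕ) :
    ∃ B : ℝ, 0 ≤ B ∧ ∀ t ∈ Icc 0 (S.τ k), ∀ x, ‖iteratedFDeriv ℝ n (s.u t) x‖ ≤ B :=
  (s.hasBoundedSobolevNormsOn hν).exists_forall_norm_iteratedFDeriv_le
    (fun _ ht => s.contDiff_slice ht) n

/-- **The velocity gradient of a stage is bounded on the slab** (`n = 1`): a finite uniform gradient
CEILING sits over the register's strain floors `c₁ A_j ≤ ‖Du(τ_j, x_j)‖`. [cite: AdamsFournier2003, Thm. 4.12] -/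
theorem exists_norm_fderiv_le (hν : 0 < ν) (s : Stage ν R S m k) :
    ∃ B : ℝ, 0 ≤ B ∧ ∀ t ∈ Icc 0 (S.τ k), ∀ x, ‖fderiv ℝ (s.u t) x‖ ≤ B := by
  obtain ⟨B, hB0, hB⟩ := s.exists_norm_iteratedFDeriv_le hν 1
  refine ⟨B, hB0, fun t ht x => ?_⟩
  have h := hB t ht x
  rwa [← norm_iteratedFDeriv_fderiv (n := 0), norm_iteratedFDeriv_zero] at h

/-- **The velocity itself is bounded on the slab by a constant read off Tao's class** (`n = 0`; of
course the stage's own ceiling `c₂ Y_k` is the quantitative bound — `Stage.norm_le_ceiling_top`).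
[cite: AdamsFournier2003, Thm. 4.12] -/
theorem exists_norm_le (hν : 0 < ν) (s : Stage ν R S m k) :
    ∃ B : ℝ, 0 ≤ B ∧ ∀ t ∈ Icc 0 (S.τ k), ∀ x, ‖s.u t x‖ ≤ B := by
  obtain ⟨B, hB0, hB⟩ := s.exists_norm_iteratedFDeriv_le hν 0
  exact ⟨B, hB0, fun t ht x => by simpa using hB t ht x⟩

/-- The quantitative velocity bound of the register: on the whole slab `[0, τ_k]` the speed is at
most the top ceiling `c₂ Y_k` (any `ν`). [cite: Palasek2026ElementaryModel, §3.3] -/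
theorem norm_le_ceiling_top (s : Stage ν R S m k) {t : ℝ} (ht : t ∈ Icc 0 (S.τ k))
    (x : EuclideanSpace ℝ (Fin 3)) : ‖s.u t x‖ ≤ S.c₂ * R.Y k :=
  s.ceiling k le_rfl t ht x

/-- **Every slice of a stage is Lipschitz, with one constant for the whole slab** (mean value
inequality with the gradient bound of `exists_norm_fderiv_le`). [folklore] -/
theorem exists_lipschitz (hν : 0 < ν) (s : Stage ν R S m k) :
    ∃ L : ℝ, 0 ≤ L ∧ ∀ t ∈ Icc 0 (S.τ k), ∀ x y, ‖s.u t x - s.u t y‖ ≤ L * ‖x - y‖ := by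
  obtain ⟨B, hB0, hB⟩ := s.exists_norm_fderiv_le hν
  refine ⟨B, hB0, fun t ht x y => ?_⟩
  have hd : Differentiable ℝ (s.u t) := (s.contDiff_slice ht).differentiable (by simp)
  exact Convex.norm_image_sub_le_of_norm_fderiv_le (fun z _ => hd.differentiableAt)
    (fun z _ => hB t ht z) convex_univ (mem_univ y) (mem_univ x)

/-! ## §3 Every slice vanishes at spatial infinity -/

/-- **Every slice of a stage tends to zero at spatial infinity** (`ν > 0`): a finite-energy field
with a global Lipschitz bound cannot keep speed `≥ ε` on balls escaping to infinity (tree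
`tendsto_cocompact_of_eEnergy_lt_top`). So no registered flow has a speed plateau at infinity and
every spatial supremum below is a maximum. [folklore] -/
theorem tendsto_cocompact (hν : 0 < ν) (s : Stage ν R S m k) {t : ℝ} (ht : t ∈ Icc 0 (S.τ k)) :
    Tendsto (s.u t) (cocompact (EuclideanSpace ℝ (Fin 3))) (𝓝 0) := by
  obtain ⟨L, -, hL⟩ := s.exists_lipschitz hν
  obtain ⟨C, hCt, hC⟩ := s.energy
  have hE : eEnergy (s.u t) < ⊤ := lt_of_le_of_lt (hC t ht) hCt
  exact tendsto_cocompact_of_eEnergy_lt_top (s.contDiff_slice ht).continuous (hL t ht) hE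

/-- The speed of a slice is eventually (near spatial infinity) below any positive level. [folklore] -/
theorem eventually_norm_lt (hν : 0 < ν) (s : Stage ν R S m k) {t : ℝ} (ht : t ∈ Icc 0 (S.τ k))
    {ε : ℝ} (hε : 0 < ε) :
    ∀ᶠ x in cocompact (EuclideanSpace ℝ (Fin 3)), ‖s.u t x‖ < ε := by
  have h := Metric.tendsto_nhds.1 (s.tendsto_cocompact hν ht) ε hε
  filter_upwards [h] with x hx
  rwa [dist_zero_right] at hx

/-! ## §4 The global speed maximum is attained at every time of the slab -/

/-- **At every time `t ∈ [0, τ_k]` the global speed maximum of a stage is ATTAINED**: there is `x₀`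
with `‖u(t, x)‖ ≤ ‖u(t, x₀)‖` for all `x` (a continuous function vanishing at infinity attains its
maximum; if the slice vanishes identically any point does). [folklore] -/
theorem exists_isMaxOn_norm (hν : 0 < ν) (s : Stage ν R S m k) {t : ℝ} (ht : t ∈ Icc 0 (S.τ k)) :
    ∃ x₀ : EuclideanSpace ℝ (Fin 3), ∀ x, ‖s.u t x‖ ≤ ‖s.u t x₀‖ := by
  have hc : Continuous fun x => ‖s.u t x‖ := (s.contDiff_slice ht).continuous.norm
  by_cases h : ∃ x₁, 0 < ‖s.u t x₁‖
  · obtain ⟨x₁, hx₁⟩ := h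
    have hev : ∀ᶠ x in cocompact (EuclideanSpace ℝ (Fin 3)), ‖s.u t x‖ ≤ ‖s.u t x₁‖ := by
      filter_upwards [s.eventually_norm_lt hν ht hx₁] with x hx using hx.le
    exact hc.exists_forall_ge' x₁ hev
  · push Not at h
    exact ⟨0, fun x => (h x).trans (norm_nonneg _)⟩

/-- **The attained maximum at a readout lies in the registered band**: at each readout `τ_j`,
`j ≤ k`, the global speed maximum exists and satisfies `c₁ Y_j ≤ max_x ‖u(τ_j, x)‖ ≤ c₂ Y_j` (floor
at a point of the ball, ceiling everywhere). [cite: Palasek2026ElementaryModel, §3.3] -/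
theorem exists_isMaxOn_norm_readout (hν : 0 < ν) (s : Stage ν R S m k) {j : ℕ} (hj : j ≤ k) :
    ∃ x₀ : EuclideanSpace ℝ (Fin 3), (∀ x, ‖s.u (S.τ j) x‖ ≤ ‖s.u (S.τ j) x₀‖) ∧
      S.c₁ * R.Y j ≤ ‖s.u (S.τ j) x₀‖ ∧ ‖s.u (S.τ j) x₀‖ ≤ S.c₂ * R.Y j := by
  have ht : S.τ j ∈ Icc 0 (S.τ k) := ⟨(S.τ_pos j).le, S.τ_mono hj⟩
  obtain ⟨x₀, hmax⟩ := s.exists_isMaxOn_norm hν ht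
  obtain ⟨x, -, hfl⟩ := s.floor j hj
  exact ⟨x₀, hmax, hfl.trans (hmax x),
    s.ceiling j hj (S.τ j) ⟨(S.τ_pos j).le, le_rfl⟩ x₀⟩

/-- **Up to the readout `τ_j` the attained maximum is under the level-`j` ceiling**: for
`t ∈ [0, τ_j]`, `j ≤ k`, the global speed maximum exists and is `≤ c₂ Y_j`.
[cite: Palasek2026ElementaryModel, §3.3] -/
theorem exists_isMaxOn_norm_le_ceiling (hν : 0 < ν) (s : Stage ν R S m k) {j : ℕ} (hj : j ≤ k)
    {t : ℝ} (ht : t ∈ Icc 0 (S.τ j)) :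
    ∃ x₀ : EuclideanSpace ℝ (Fin 3), (∀ x, ‖s.u t x‖ ≤ ‖s.u t x₀‖) ∧ ‖s.u t x₀‖ ≤ S.c₂ * R.Y j := by
  have ht' : t ∈ Icc 0 (S.τ k) := ⟨ht.1, ht.2.trans (S.τ_mono hj)⟩
  obtain ⟨x₀, hmax⟩ := s.exists_isMaxOn_norm hν ht'
  exact ⟨x₀, hmax, s.ceiling j hj t ht x₀⟩

/-- **A speed level strictly above the level-`j` ceiling is not reached before `τ_j`**: if
`c₂ Y_j < L` then `‖u(t, x)‖ < L` for all `t ∈ [0, τ_j]`, all `x` (`j ≤ k`). With the separation pin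
(`c₂ Y_j < c₁ Y_{j+1}` under `Pins`, `Schedule.Pins.ceiling_le_floor` and `θ > 1`) this is the
statement «the floor speed of level `j+1` is reached for the FIRST time inside the growth window
`(τ_j, τ_{j+1}]`» used by the first-hitting calculus. [cite: Palasek2026ElementaryModel, §3.3] -/
theorem norm_lt_of_ceiling_lt (s : Stage ν R S m k) {j : ℕ} (hj : j ≤ k) {L : ℝ}
    (hL : S.c₂ * R.Y j < L) {t : ℝ} (ht : t ∈ Icc 0 (S.τ j)) (x : EuclideanSpace ℝ (Fin 3)) :
    ‖s.u t x‖ < L :=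
  lt_of_le_of_lt (s.ceiling j hj t ht x) hL

end Stage

end Summit.NavierStokesRegularity.FluidComputer.PalasekTowerClayBridge

end
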